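import Literature.NumberTheory.Automorphic.ArtinLFunctionsBrauerProofs
import Literature.RepresentationTheory.FiniteGroups.UnitaryWedderburn
import HarnessLib

/-!
# Contragredients in Brauer's factorisation: the conjugate character and the dual data (proofs)
(companion to `Literature.NumberTheory.Automorphic.ArtinLFunctionsBrauerProofs`; serves the named
fact `Literature.NumberTheory.Automorphic.brauer_completedArtinLFunction_eq_prod_zpow` of
`Automorphic/ArtinLFunctionsFunctionalEquation`, Neukirch VII, proof of (12.6))

In Neukirch's proof of the functional equation (VII (12.6), p. 538) the Brauer decomposition
`χ = ∑ᵢ nᵢ χᵢ*` of the character of `G(L|K)` is reused for the conjugate character: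
`χ̄ = ∑ᵢ nᵢ (χ̄ᵢ)*` with the *same* `nᵢ` and subgroups `Hᵢ = G(L|Kᵢ)`, and `χ̄` is the character of
the contragredient representation.  For the tree's framed Artin representations and Brauer data
(`IsArtinQuotient`, `ArtinRep.monomial`, `IsArtinQuotient.cutCharacter` of
`ArtinLFunctionsBrauerProofs`) this file **proves** the corresponding bookkeeping:

* `Matrix.trace_map_inv_eq_star_trace` — for a representation `ρ : G → ℂ^{n×n}` of a *finite*
  group, `tr ρ(g⁻¹) = conj (tr ρ(g))`, by Weyl's unitarian trick (`exists_conj_unitary` of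
  `Literature.RepresentationTheory.FiniteGroups.UnitaryWedderburn`: `ρ` is conjugate to a unitary
  representation, and `U⁻¹ = Uᴴ` for unitary `U`); Serre §2.1 Prop. 1 (iii);
* `FramedRep.character_toContinuousRep_eq_trace`, `FramedRep.character_dual` — the character of
  the representation on `Aⁿ` underlying a framed `ρ : G → GL_n(A)` is `tr ρ(g)`, and the
  contragredient `ρ^∨ = ((ρ ·)ᵀ)⁻¹` (`FramedRep.dual`) has character `g ↦ χ_ρ(g⁻¹)` (Serre §2.1
  Prop. 1 (ii));
* `FramedArtinRep.finite_range`, `FramedArtinRep.character_inv_eq_conj`,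
  `FramedArtinRep.character_dual_eq_conj` — a framed Artin representation `ρ : Γ_K → GL_n(ℂ)` has
  finite image (`ArtinRep.finite_range_holds`), so `χ_ρ(γ⁻¹) = conj χ_ρ(γ)` and
  **`χ_{ρ^∨} = χ̄_ρ`**;
* `starRingEnd_indClassFun`, `MonoidHom.conj_coe_apply_eq_inv`, `indClassFun_inv_eq_conj` — induction of
  class functions commutes with complex conjugation, and for a character of degree one `θ` of a
  finite group `conj ∘ θ = θ⁻¹`, so `conj (Ind_H^G θ) = Ind_H^G θ⁻¹` (Neukirch's `(χ̄ᵢ)*`);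
* `IsArtinQuotient.cutCharacter_inv` — the rank-one character of `Γ_{Kᵢ}` cut out by `(Hᵢ, θᵢ⁻¹)`
  is the contragredient `FramedRep.dual` of the one cut out by `(Hᵢ, θᵢ)` (inverse transpose of a
  `1 × 1` matrix is the inverse).

Everything here is proved; no new definitions or named facts.  Together with
`ArtinFormalismCompletedProofs` / `ArtinFormalismCompletedProdProofs` (equivalence invariance and
additivity of `Λ`) these are the inputs, besides the induction invariance (12.3) (iii) of `Λ`,
of the planned proof of `brauer_completedArtinLFunction_eq_prod_zpow`.

## Mathlib / tree search

Mathlib: `Representation.char_dual` (`ρ.dual.character g = ρ.character g⁻¹` for Mathlib's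
`Representation.dual` on `Module.Dual`, not the tree's framed inverse-transpose), no
`character g⁻¹ = conj (character g)` for finite groups over `ℂ` (`lean search 'char_inv'`:
nothing); `Matrix.trace_conjTranspose`, `Matrix.trace_mul_cycle`, `Matrix.left_inv_eq_left_inv`,
`Complex.inv_eq_conj`, `Function.apply_extend`.  Tree: `exists_conj_unitary`
(`UnitaryWedderburn`), `FramedRep.dual`/`coe_dual_apply`, `FramedRep.trace`,
`ArtinRep.finite_range_holds`, `isOfFinOrder_apply_of_finite_range`, `indClassFun`,
`IsArtinQuotient.cutCharacter` (`cutCharacter_apply_coe`, `cutHom_apply`);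
`FramedRep.charpoly_dual_of_finite_range` (`FramedRepDualProofs`) is the `2 × 2` characteristic
polynomial analogue.  Nothing here duplicates an existing declaration.

## References

* J. Neukirch, *Algebraic Number Theory* (1999), VII, proof of (12.6), p. 538 (`NeukirchANT1999`).
* J.-P. Serre, *Linear Representations of Finite Groups* (1977), §1.3 Remark (unitarisability),
  §2.1 Prop. 1 (ii)–(iii), §7.2 (`SerreLinearRepresentations1977`).
-/

noncomputable section

open scoped NumberField ComplexConjugate Matrix
open Field Module Literature.RepresentationTheory.FiniteGroups

/-! ### Traces of inverses for representations of finite groups -/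

/-- **`tr ρ(g⁻¹) = conj tr ρ(g)` for a complex matrix representation of a finite group** (Serre,
*Linear Representations*, §2.1 Prop. 1 (iii): `χ(s⁻¹) = χ(s)*`).  Proof by Weyl's unitarian trick
(`exists_conj_unitary`, Serre §1.3 Remark): `u ρ(g) u⁻¹ = U` with `Uᴴ U = 1`, so
`ρ(g⁻¹) = ρ(g)⁻¹ = u⁻¹ Uᴴ u` and `tr ρ(g⁻¹) = tr Uᴴ = conj tr U = conj tr ρ(g)`.  (Declared in
Mathlib's `Matrix` namespace as a deliberate dot-notation-style extension next to
`Matrix.trace_conjTranspose`.) [cite: SerreLinearRepresentations1977, §2.1 Prop. 1 (iii)] -/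
theorem Matrix.trace_map_inv_eq_star_trace {n : Type*} [Fintype n] [DecidableEq n] {G : Type*}
    [Group G] [Finite G] (ρ : G →* Matrix n n ℂ) (g : G) :
    (ρ g⁻¹).trace = star (ρ g).trace := by
  obtain ⟨u, hu⟩ := exists_conj_unitary ρ
  set U : Matrix n n ℂ := (u : Matrix n n ℂ) * ρ g * ((u⁻¹ : (Matrix n n ℂ)ˣ) : Matrix n n ℂ)
    with hU
  have hUU : Uᴴ * U = 1 := hu g
  have hUu : U * (u : Matrix n n ℂ) = (u : Matrix n n ℂ) * ρ g := by
    rw [hU, Matrix.mul_assoc, Matrix.mul_assoc, Units.inv_mul, Matrix.mul_one]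
  -- `ρ g⁻¹ = u⁻¹ Uᴴ u`: both are left inverses of `ρ g`
  have h1 : ρ g⁻¹ * ρ g = 1 := by rw [← map_mul, inv_mul_cancel, map_one]
  have h2 : ((u⁻¹ : (Matrix n n ℂ)ˣ) : Matrix n n ℂ) * Uᴴ * (u : Matrix n n ℂ) * ρ g = 1 := by
    calc ((u⁻¹ : (Matrix n n ℂ)ˣ) : Matrix n n ℂ) * Uᴴ * (u : Matrix n n ℂ) * ρ g
        = ((u⁻¹ : (Matrix n n ℂ)ˣ) : Matrix n n ℂ) * (Uᴴ * (U * (u : Matrix n n ℂ))) := by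
          rw [hUu]; simp only [Matrix.mul_assoc]
      _ = 1 := by rw [← Matrix.mul_assoc Uᴴ, hUU, Matrix.one_mul, Units.inv_mul]
  have h3 : ρ g⁻¹ = ((u⁻¹ : (Matrix n n ℂ)ˣ) : Matrix n n ℂ) * Uᴴ * (u : Matrix n n ℂ) :=
    Matrix.left_inv_eq_left_inv h1 h2
  have h4 : (ρ g).trace = U.trace := by
    rw [hU, Matrix.trace_mul_cycle, Units.inv_mul, Matrix.one_mul]
  rw [h3, Matrix.trace_mul_cycle, Units.mul_inv, Matrix.one_mul, Matrix.trace_conjTranspose, h4]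

namespace Literature.NumberTheory.GaloisRepresentations

universe u

/-! ### The character of the contragredient framed representation -/

namespace FramedRep

variable {G : Type*} [Group G] [TopologicalSpace G] {A : Type*} [Field A] [TopologicalSpace A]
  [IsTopologicalRing A] {n : ℕ}

/-- The linear map `ρ(g)` on `Aⁿ` underlying a framed representation is `toLin'` of the matrix
`ρ(g)`. [folklore] -/
theorem toContinuousRep_apply_eq_toLin' (ρ : FramedRep G A n) (g : G) :
    (ρ.toContinuousRep g : (Fin n → A) →ₗ[A] (Fin n → A)) =
      Matrix.toLin' ((ρ g : GL (Fin n) A) : Matrix (Fin n) (Fin n) A) := by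
  refine LinearMap.ext fun v => ?_
  rw [Matrix.toLin'_apply]
  rfl

/-- **The character of the representation on `Aⁿ` underlying a framed `ρ` is the matrix trace**
`tr ρ(g)` (`FramedRep.trace`; Mathlib `Matrix.trace_toLin'_eq`).
Ref: Serre, *Linear Representations of Finite Groups*, §2.1. [folklore] -/
theorem character_toContinuousRep_eq_trace (ρ : FramedRep G A n) (g : G) :
    ρ.toContinuousRep.toRepresentation.character g = ρ.trace g := by
  simp only [Representation.character]
  rw [ContinuousRep.toRepresentation_apply, toContinuousRep_apply_eq_toLin', Matrix.trace_toLin'_eq]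
  rfl

/-- **The contragredient has character `g ↦ χ(g⁻¹)`**: for a framed `ρ : G → GL_n(A)`,
`χ_{ρ^∨}(g) = tr ((ρ g)ᵀ)⁻¹ = tr ρ(g)⁻¹ = χ_ρ(g⁻¹)` (`FramedRep.dual`).
Ref: Serre, *Linear Representations of Finite Groups*, §2.1 Prop. 1 (ii) (with §1.4).
[cite: SerreLinearRepresentations1977, §2.1 Prop. 1 (ii)] -/
theorem character_dual (ρ : FramedRep G A n) (g : G) :
    (FramedRep.dual ρ).toContinuousRep.toRepresentation.character g =
      ρ.toContinuousRep.toRepresentation.character g⁻¹ := by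
  rw [character_toContinuousRep_eq_trace, character_toContinuousRep_eq_trace, FramedRep.trace,
    FramedRep.trace, coe_dual_apply, Matrix.trace_transpose, map_inv]

end FramedRep

/-! ### Framed Artin representations: finite image and the conjugate character -/

namespace FramedArtinRep

variable {K : Type u} [Field K] [NumberField K] {n : ℕ}

/-- **A framed Artin representation has finite image** (`ArtinRep.finite_range_holds` for the
representation on `ℂⁿ`, transported along the faithful standard representation
`M ↦ Matrix.toLin' M`).  Ref: Serre, *Abelian ℓ-adic representations and elliptic curves* (1968),
Ch. I §1.1, Remark. [cite: SerreAbelianLadic1968, Ch. I §1.1 Remark] -/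
theorem finite_range (ρ : FramedArtinRep K n) : (Set.range ρ).Finite := by
  have h := ArtinRep.finite_range_holds (K := K) (V := Fin n → ℂ) ρ.toArtinRep
  refine Set.Finite.of_finite_image (f := fun M : GL (Fin n) ℂ =>
    Matrix.toLin' (M : Matrix (Fin n) (Fin n) ℂ)) ?_ fun a _ b _ hab =>
      Units.ext (Matrix.toLin'.injective hab)
  rw [← Set.range_comp]
  have hfun : ((fun M : GL (Fin n) ℂ => Matrix.toLin' (M : Matrix (Fin n) (Fin n) ℂ)) ∘ ρ) =
      fun γ => (ρ.toArtinRep γ : (Fin n → ℂ) →ₗ[ℂ] (Fin n → ℂ)) := by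
    funext γ
    exact (FramedRep.toContinuousRep_apply_eq_toLin' ρ γ).symm
  rw [hfun]
  exact h

/-- **`χ_ρ(γ⁻¹) = conj χ_ρ(γ)` for a framed Artin representation** `ρ : Γ_K → GL_n(ℂ)`: the image
`ρ(Γ_K)` is a finite group (`finite_range`), to which `Matrix.trace_map_inv_eq_star_trace`
(unitarian trick) applies.  Ref: Serre, *Linear Representations of Finite Groups*, §2.1 Prop. 1
(iii). [cite: SerreLinearRepresentations1977, §2.1 Prop. 1 (iii)] -/
theorem character_inv_eq_conj (ρ : FramedArtinRep K n) (γ : absoluteGaloisGroup K) :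
    ρ.toArtinRep.toRepresentation.character γ⁻¹ = conj (ρ.toArtinRep.toRepresentation.character γ) := by
  haveI : Finite ρ.toMonoidHom.range := by
    have h4 : (ρ.toMonoidHom.range : Set (GL (Fin n) ℂ)) = Set.range ρ := by
      rw [MonoidHom.coe_range]; rfl
    exact Set.finite_coe_iff.mpr (h4 ▸ ρ.finite_range)
  let ι : ρ.toMonoidHom.range →* Matrix (Fin n) (Fin n) ℂ :=
    (Units.coeHom (Matrix (Fin n) (Fin n) ℂ)).comp ρ.toMonoidHom.range.subtype
  have hι : ∀ δ : absoluteGaloisGroup K,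
      ι ⟨ρ.toMonoidHom δ, ⟨δ, rfl⟩⟩ = ((ρ δ : GL (Fin n) ℂ) : Matrix (Fin n) (Fin n) ℂ) := fun _ => rfl
  have h := Matrix.trace_map_inv_eq_star_trace ι ⟨ρ.toMonoidHom γ, ⟨γ, rfl⟩⟩
  have hinv : (⟨ρ.toMonoidHom γ, ⟨γ, rfl⟩⟩ : ρ.toMonoidHom.range)⁻¹ =
      ⟨ρ.toMonoidHom γ⁻¹, ⟨γ⁻¹, rfl⟩⟩ := Subtype.ext (map_inv ρ.toMonoidHom γ).symm
  rw [hinv, hι, hι] at h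
  rw [show ρ.toArtinRep = FramedRep.toContinuousRep ρ from rfl,
    FramedRep.character_toContinuousRep_eq_trace, FramedRep.character_toContinuousRep_eq_trace]
  exact h

/-- **The contragredient of a framed Artin representation has the conjugate character**,
`χ_{ρ^∨} = χ̄_ρ` (`FramedRep.character_dual` and `character_inv_eq_conj`).  This is the identity
behind "`Λ(L|K, χ̄, 1 - s)`" in Neukirch's functional equation, `χ̄` being realised by `ρ^∨`.
Ref: Serre, *Linear Representations of Finite Groups*, §2.1 Prop. 1 (ii)–(iii); Neukirch VII
(12.6). [cite: SerreLinearRepresentations1977, §2.1 Prop. 1] -/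
theorem character_dual_eq_conj (ρ : FramedArtinRep K n) (γ : absoluteGaloisGroup K) :
    (FramedArtinRep.toArtinRep (FramedRep.dual ρ)).toRepresentation.character γ =
      conj (ρ.toArtinRep.toRepresentation.character γ) := by
  rw [← character_inv_eq_conj]
  exact FramedRep.character_dual ρ γ

end FramedArtinRep

end Literature.NumberTheory.GaloisRepresentations

/-! ### Induced class functions and conjugation -/

namespace Literature.RepresentationTheory.FiniteGroups

variable {G : Type} [Group G] [Fintype G]

/-- **Induction commutes with complex conjugation**: `conj ∘ Ind_H^G φ = Ind_H^G (conj ∘ φ)`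
(the defining sum `(1/|H|) ∑_t φ̇(t⁻¹ s t)` has real normalisation).
Ref: Serre, *Linear Representations of Finite Groups*, §7.2. [cite: SerreLinearRepresentations1977, §7.2] -/
theorem starRingEnd_indClassFun (H : Subgroup G) (φ : H → ℂ) (s : G) :
    conj (indClassFun H φ s) = indClassFun H (fun h => conj (φ h)) s := by
  simp only [indClassFun, map_mul, map_inv₀, map_natCast, map_sum]
  congr 1
  refine Finset.sum_congr rfl fun t _ => ?_
  rw [Function.apply_extend (starRingEnd ℂ)]
  congr 1
  all_goals funext x; simp [Function.comp_apply]

/-- For a character of degree one `θ` of a finite group, `conj θ(h) = θ(h)⁻¹` (`θ(h)` is a root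
of unity, of absolute value `1`; Mathlib `Complex.inv_eq_conj`).
Ref: Serre, *Linear Representations of Finite Groups*, §2.1 Prop. 1 (iii). [folklore] -/
theorem MonoidHom.conj_coe_apply_eq_inv {H : Type*} [Group H] [Finite H] (θ : H →* ℂˣ) (h : H) :
    conj ((θ h : ℂˣ) : ℂ) = (((θ⁻¹ h : ℂˣ)) : ℂ) := by
  have hfin : IsOfFinOrder ((θ h : ℂˣ) : ℂ) :=
    (Units.coeHom ℂ).isOfFinOrder (θ.isOfFinOrder (isOfFinOrder_of_finite h))
  have hnorm : ‖((θ h : ℂˣ) : ℂ)‖ = 1 := hfin.norm_eq_one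
  rw [MonoidHom.inv_apply, Units.val_inv_eq_inv_val, Complex.inv_eq_conj hnorm]

/-- **`conj (Ind_H^G θ) = Ind_H^G θ⁻¹`** for a character of degree one `θ` of `H ≤ G` (Neukirch's
`(χ̄ᵢ)*` in the proof of VII (12.6): the conjugate of a monomial character is the monomial
character of the inverse character). [cite: NeukirchANT1999, VII (12.6) proof] -/
theorem indClassFun_inv_eq_conj (H : Subgroup G) (θ : H →* ℂˣ) (s : G) :
    indClassFun H (fun h => ((θ⁻¹ h : ℂˣ) : ℂ)) s = conj (indClassFun H (fun h => (θ h : ℂ)) s) := by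
  rw [starRingEnd_indClassFun]
  congr 1
  funext h
  exact (MonoidHom.conj_coe_apply_eq_inv θ h).symm

end Literature.RepresentationTheory.FiniteGroups

/-! ### The cut-out character of the inverse is the contragredient -/

namespace Literature.NumberTheory.Automorphic

universe u

namespace IsArtinQuotient

variable {K : Type u} [Field K] [NumberField K] {G : Type} [Group G]
  {q : absoluteGaloisGroup K →* G} (hq : IsArtinQuotient q) (H : Subgroup G) (θ : H →* ℂˣ)
include hq

/-- **The character of `Γ_{Kᵢ}` cut out by `(Hᵢ, θᵢ⁻¹)` is the contragredient of the one cut out by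
`(Hᵢ, θᵢ)`**: `cutCharacter Hᵢ θᵢ⁻¹ = (cutCharacter Hᵢ θᵢ)^∨` (`FramedRep.dual`, inverse transpose;
for `1 × 1` matrices this is the inverse, and `θ⁻¹(x) = θ(x)⁻¹`).  With
`FramedArtinRep.character_dual_eq_conj` this realises Neukirch's `χ̄ᵢ` on `Γ_{Kᵢ}`.
[cite: NeukirchANT1999, VII (12.6) proof] -/
theorem cutCharacter_inv :
    hq.cutCharacter H θ⁻¹ = GaloisRepresentations.FramedRep.dual (hq.cutCharacter H θ) := by
  refine ContinuousMonoidHom.ext fun δ => Units.ext (Matrix.ext fun i j => ?_)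
  rw [hq.cutCharacter_apply_coe, GaloisRepresentations.FramedRep.coe_dual_apply,
    Matrix.transpose_apply, ← map_inv (hq.cutCharacter H θ) δ, hq.cutCharacter_apply_coe,
    hq.cutHom_apply, hq.cutHom_apply, map_inv (hq.cutHomAux H) δ, map_inv θ, MonoidHom.inv_apply]

end IsArtinQuotient

end Literature.NumberTheory.Automorphic

end
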